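import Mathlib
import Literature.NumberTheory.Automorphic.AutomorphicInductionCharacterCubicProofs
import Literature.NumberTheory.Automorphic.GLOneArchParameterOfAlgebraicCharacter
import Literature.NumberTheory.Automorphic.InfinityTypeAutomorphicInduction
import Literature.NumberTheory.Automorphic.AutomorphicInductionUnitaryCharacterCubicArchimedean
import Summits.Langlands.Langlands.Theses.PicardMuOrdinary
import Summits.Langlands.Langlands.Theorems.PicardMuOrdinaryResidualAutomorphyEvenTheta

/-!
# `ResidualAutomorphyEven` from non-normal cubic automorphic induction with archimedean components

Item stmt-Langlands-13760 (route `PicardMuOrdinary`).  We prove the route decl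
`Summit.Langlands.Langlands.Theses.PicardMuOrdinary.ResidualAutomorphyEven` VERBATIM, conditionally on one
named fact of the tree (D-0014): Jacquet–Piatetski-Shapiro–Shalika's automorphic induction of a unitary
Hecke character through a cubic, not necessarily Galois, extension, with the cuspidality clause of
`automorphicInduction_unitaryCharacter_cubic` AND its archimedean components
(`Literature.NumberTheory.Automorphic.automorphicInduction_unitaryCharacter_cubic_archimedean`,
file `AutomorphicInductionUnitaryCharacterCubicArchimedean`).

Proof (`residualAutomorphyEven_of_cubicAI_archimedean`).  For `f` as in the decl let `E ⊇ K = ℚ(ω)` be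
the cubic resolvent field (a CM sextic) and `θ = ε ψ χ₀` the unitary algebraic Hecke character of `E` of
the `Theta` file (infinity type `(p, q)` with exponents `{1, 0, -1}` above each embedding of `K`;
`N w · θ(ϖ_w) ∈ ℤ̄`, `≡ ε(ϖ_w) (mod 𝔐)` a.e.; cuspidality datum).  The fact gives a cuspidal `P` on
`GL₃(𝔸_K)` with Satake polynomials `∏_{w ∣ v} (X^{f(w|v)} - θ(ϖ_w))` a.e. and the induced archimedean
parameter `σ ↦ {-n_{σ'} : σ' ∣ σ}` (the parameter of `π_θ` being `ι ↦ {-n_ι}`,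
`hasArchParameter_of_hasInfinityType_heckeCharacter_glOne`).  Then:
* `P` is regular algebraic (`isRegularAlgebraic_of_archParameter`): it has the induced infinity type
  `T_θ^{E/K}` (`InfinityType.automorphicInduction`), integral (`C`-algebraic for `n = 3`) and regular;
* at almost every `v`, `Q = ∏_{w ∣ v} (X^{f(w|v)} - z_w) ∈ ℤ̄[X]` (`z_w = N v^{f(w|v)} θ(ϖ_w)`) maps to
  `∏_{a ∈ α} (X - N v · a)` in `ℂ[X]` (`prod_X_sub_C_mul_eq`: scaling the roots of
  `∏_a (X - a) = ∏_w (X^{f_w} - θ_w)`) and to the branch-point table modulo `𝔐` (`z_w ≡ ε(ϖ_w) = ±1`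
  and `∏_{w ∣ v} (X^{f(w|v)} - ε(ϖ_w)) = T(f, v)`, the `Milestone` file).
-/

set_option linter.dupNamespace false -- project-wide option (lakefile weak.linter.dupNamespace); `Summit.Langlands.Langlands` is the mandated namespace

noncomputable section

namespace Summit.Langlands.Langlands.Theorems

open Polynomial Finset NumberField NumberField.InfinitePlace IsDedekindDomain Filter
open Literature.NumberTheory.GaloisRepresentations Literature.NumberTheory.Automorphic
  Literature.NumberTheory.LFunctions
open scoped Classical

namespace ResidualAutomorphyEven

/-! ### Regular algebraicity from the induced archimedean parameter -/

/-- `∑_{x ∈ s} {g x} = s.val.map g` as multisets. -/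
theorem sum_singleton_eq_map {ι β : Type*} (s : Finset ι) (g : ι → β) :
    ∑ x ∈ s, ({g x} : Multiset β) = s.val.map g := by
  induction s using Finset.induction_on with
  | empty => simp
  | insert a s has ih => rw [sum_insert has, ih, insert_val_of_notMem has, Multiset.map_cons, Multiset.singleton_add]

/-- **A cuspidal representation of `GL₃(𝔸_K)` with the archimedean parameter induced from an algebraic
Hecke character of a cubic extension `L/K` with pairwise distinct exponents above each embedding of `K` is
regular algebraic**: it has the induced infinity type `σ ↦ ∑_{σ' ∣ σ} {(-n_{σ'}, -n_{σ̄'})}`, which is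
integral and regular. -/
theorem isRegularAlgebraic_of_archParameter {K L : Type} [Field K] [NumberField K] [Field L] [NumberField L]
    [Algebra K L] (hKL : Module.finrank K L = 3) {hK : isCompact_glFiniteIntegralLevel 3 K}
    (P : AutomorphicRepData (AutomorphyDatum.gl 3 K hK)) (p q : InfinitePlace L → ℤ)
    (hinj : ∀ σ : K →+* ℂ, Set.InjOn (fun σ' => HeckeCharacter.embExponent p q σ')
      {σ' : L →+* ℂ | σ'.comp (algebraMap K L) = σ})
    (hP : P.HasArchParameter fun σ =>
      ∑ σ' ∈ Finset.univ.filter (fun σ' : L →+* ℂ => σ'.comp (algebraMap K L) = σ),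
        ({-((HeckeCharacter.embExponent p q σ' : ℤ) : ℂ)} : Multiset ℂ)) :
    P.IsRegularAlgebraic := by
  -- the rank-one infinity type of `θ` and its automorphic induction
  set n : (L →+* ℂ) → ℤ := HeckeCharacter.embExponent p q with hn
  let T : InfinityType L 1 := fun ι ↦
    {⟨-((n ι : ℤ) : ℂ), -((n (ComplexEmbedding.conjugate ι) : ℤ) : ℂ),
      ⟨-n ι + n (ComplexEmbedding.conjugate ι), by push_cast; ring⟩⟩}
  have hTa : ∀ ι : L →+* ℂ, (T ι).map ArchWeight.a = {-((n ι : ℤ) : ℂ)} := fun ι ↦ by simp [T]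
  have hTwf : T.IsWellFormed := by
    refine ⟨fun ι ↦ by simp [T], fun ι ↦ ?_⟩
    simp only [T, Multiset.map_singleton]
    congr 1
    ext
    · rfl
    · simp [ArchWeight.swap, ComplexEmbedding.involutive_conjugate L ι]
  have hN : 3 = 1 * Module.finrank K L := by rw [hKL]
  have hwf : (T.automorphicInduction K 3).IsWellFormed := hTwf.automorphicInduction hN
  have hmap : ∀ σ : K →+* ℂ, (T.automorphicInduction K 3 σ).map ArchWeight.a =
      ∑ σ' ∈ Finset.univ.filter (fun σ' : L →+* ℂ => σ'.comp (algebraMap K L) = σ), {-((n σ' : ℤ) : ℂ)} := by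
    intro σ
    rw [InfinityType.map_automorphicInduction]
    exact Finset.sum_congr rfl fun σ' _ => hTa σ'
  have hPT : P.HasInfinityType (T.automorphicInduction K 3) := by
    refine ⟨hwf, ?_⟩
    have e : (fun σ : K →+* ℂ => (T.automorphicInduction K 3 σ).map ArchWeight.a) =
        fun σ => ∑ σ' ∈ Finset.univ.filter (fun σ' : L →+* ℂ => σ'.comp (algebraMap K L) = σ),
          ({-((HeckeCharacter.embExponent p q σ' : ℤ) : ℂ)} : Multiset ℂ) := funext hmap
    rw [e]; exact hP
  refine ⟨_, hPT, fun σ w hw => ?_, fun σ => ?_⟩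
  · -- `C`-algebraic: the exponents are integers and `(3 - 1)/2 = 1`
    rw [InfinityType.automorphicInduction_apply] at hw
    obtain ⟨σ', -, hw'⟩ := Multiset.mem_sum.mp hw
    simp only [T, Multiset.mem_singleton] at hw'
    subst hw'
    refine ⟨-n σ' - 1, -n (ComplexEmbedding.conjugate σ') - 1, ?_, ?_⟩ <;> push_cast <;> ring
  · -- regular: the exponents above `σ` are pairwise distinct
    rw [hmap, sum_singleton_eq_map]
    refine Multiset.Nodup.map_on (fun a ha b hb hab => ?_) (Finset.univ.filter _).nodup
    have ha' : a.comp (algebraMap K L) = σ := by simpa using ha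
    have hb' : b.comp (algebraMap K L) = σ := by simpa using hb
    have hab' : n a = n b := by exact_mod_cast neg_injective hab
    exact hinj σ ha' hb' hab'

/-! ### Scaling the roots of an induced Satake polynomial -/

/-- **`∏_{a ∈ α} (X - q a) = ∏_i (X^{d_i} - q^{d_i} t_i)` when `∏_{a ∈ α} (X - a) = ∏_i (X^{d_i} - t_i)`**
(`q ≠ 0`, `d_i ≥ 1`): substitute `X ↦ q⁻¹ X` and clear denominators. -/
theorem prod_X_sub_C_mul_eq {ι : Type*} (s : Finset ι) (d : ι → ℕ) (hd : ∀ i ∈ s, 0 < d i) (t : ι → ℂ)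
    {α : Multiset ℂ} {q : ℂ} (hq : q ≠ 0)
    (hα : (α.map fun a => X - C a).prod = ∏ i ∈ s, (X ^ d i - C (t i))) :
    (α.map fun a => X - C (q * a)).prod = ∏ i ∈ s, (X ^ d i - C (q ^ d i * t i)) := by
  set Lq : ℂ[X] := C q⁻¹ * X with hLq
  -- degrees: `card α = ∑ d_i`
  have hdeg : Multiset.card α = ∑ i ∈ s, d i := by
    have h1 := congrArg natDegree hα
    rw [natDegree_multiset_prod_X_sub_C_eq_card, natDegree_prod_of_monic _ _
      (fun i hi => monic_X_pow_sub_C (t i) (hd i hi).ne')] at h1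
    rw [h1]
    exact Finset.sum_congr rfl fun i hi => natDegree_X_pow_sub_C
  -- `X - q a = q · (X - a) ∘ (q⁻¹ X)`
  have hqq : C q * C q⁻¹ = (1 : ℂ[X]) := by rw [← C_mul, mul_inv_cancel₀ hq, C_1]
  have hfac : ∀ a : ℂ, X - C (q * a) = C q * (X - C a).comp Lq := fun a => by
    rw [sub_comp, X_comp, C_comp, hLq, mul_sub, ← mul_assoc, hqq, one_mul, C_mul]
  have hL : (α.map fun a => X - C (q * a)).prod = C q ^ Multiset.card α * ((α.map fun a => X - C a).prod).comp Lq := by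
    rw [Multiset.map_congr rfl fun a _ => hfac a, Multiset.prod_map_mul, Multiset.map_const', Multiset.prod_replicate,
      multiset_prod_comp, Multiset.map_map]
    rfl
  rw [hL, hα, Polynomial.prod_comp, hdeg, ← prod_pow_eq_pow_sum, ← prod_mul_distrib]
  refine Finset.prod_congr rfl fun i _ => ?_
  have hqq' : C q ^ d i * C q⁻¹ ^ d i = (1 : ℂ[X]) := by rw [← mul_pow, hqq, one_pow]
  rw [sub_comp, X_pow_comp, C_comp, mul_sub, hLq, mul_pow, ← mul_assoc, hqq', one_mul, ← C_pow, ← C_mul]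

/-! ### The Hecke polynomial `Q ∈ ℤ̄[X]` at a good place -/

section Hecke

variable {L : Type} [Field L] [NumberField L] [Algebra K L]

/-- **The polynomial `Q` at a good place.**  Let `v` be a finite place of `K`, `θ` a Hecke character
of `L ⊇ K`, `𝔐` an ideal of `ℤ̄`, `T ∈ ℤ[X]`, and suppose: `α` is a multiset with
`∏_{a ∈ α} (X - a) = ∏_{w ∣ v} (X^{f(w|v)} - θ(ϖ_w))`; every `w ∣ v` carries `z_w ∈ ℤ̄` with
`z_w = N w · θ(ϖ_w)` and `z_w ≡ s_w (mod 𝔐)` for a sign `s_w = ±1 ∈ ℤ` with `s_w = ε_w`; and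
`∏_{w ∣ v} (X^{f(w|v)} - ε_w) = T` in `ℂ[X]`.  Then some `Q ∈ ℤ̄[X]` has `Q = ∏_{a ∈ α} (X - N v · a)`
in `ℂ[X]` and `Q ≡ T (mod 𝔐)`. -/
theorem exists_Q (v : HeightOneSpectrum (𝓞 K)) (θ : HeckeCharacter L) (𝔐 : Ideal (integralClosure ℤ ℂ))
    (T : ℤ[X]) (ε : HeightOneSpectrum (𝓞 L) → ℂ) (sgn : HeightOneSpectrum (𝓞 L) → ℤ)
    (hsgn : ∀ w, (sgn w : ℂ) = ε w) {α : Multiset ℂ}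
    (hα : satakePolynomial α = ∏ᶠ w ∈ {w : HeightOneSpectrum (𝓞 L) | w.under (𝓞 K) = v},
      (X ^ w.asIdeal.inertiaDeg (𝓞 K) - C (θ.valueAtUniformizer w)))
    (hz : ∀ w : HeightOneSpectrum (𝓞 L), w.under (𝓞 K) = v → ∃ z : integralClosure ℤ ℂ,
      algebraMap (integralClosure ℤ ℂ) ℂ z = (w.residueCard : ℂ) * θ.valueAtUniformizer w ∧
        Ideal.Quotient.mk 𝔐 z = Ideal.Quotient.mk 𝔐 (sgn w : integralClosure ℤ ℂ))
    (hT : ∏ᶠ w ∈ {w : HeightOneSpectrum (𝓞 L) | w.under (𝓞 K) = v},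
      (X ^ w.asIdeal.inertiaDeg (𝓞 K) - C (ε w)) = T.map (Int.castRingHom ℂ)) :
    ∃ Q : Polynomial (integralClosure ℤ ℂ),
      Q.map (algebraMap (integralClosure ℤ ℂ) ℂ) = (α.map fun a => X - C ((v.residueCard : ℂ) * a)).prod ∧
      Q.map (Ideal.Quotient.mk 𝔐) = T.map (Int.castRingHom (integralClosure ℤ ℂ ⧸ 𝔐)) := by
  have hfin := finite_setOf_under_eq' (F := K) (E := L) v
  set S := hfin.toFinset with hS
  have hmemS : ∀ w, w ∈ S ↔ w.under (𝓞 K) = v := fun w => by rw [hS, Set.Finite.mem_toFinset, Set.mem_setOf_eq]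
  rw [finprod_mem_eq_finite_toFinset_prod _ hfin] at hα hT
  choose z hz1 hz2 using hz
  refine ⟨∏ w ∈ S.attach, (X ^ w.1.asIdeal.inertiaDeg (𝓞 K) - C (z w.1 ((hmemS w.1).mp w.2))), ?_, ?_⟩
  · -- over `ℂ`: scale the roots of `∏_a (X - a) = ∏_w (X^{f_w} - θ_w)`
    have hq : (v.residueCard : ℂ) ≠ 0 := by
      have := v.one_lt_residueCard; exact_mod_cast (by omega : v.residueCard ≠ 0)
    rw [Polynomial.map_prod]
    have hα' : (α.map fun a => X - C a).prod = ∏ w ∈ S.attach, (X ^ w.1.asIdeal.inertiaDeg (𝓞 K) - C (θ.valueAtUniformizer w.1)) := by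
      rw [prod_attach S (fun w => X ^ w.asIdeal.inertiaDeg (𝓞 K) - C (θ.valueAtUniformizer w))]
      exact hα
    rw [prod_X_sub_C_mul_eq S.attach (fun w => w.1.asIdeal.inertiaDeg (𝓞 K))
      (fun w _ => by haveI := w.1.isPrime; exact Ideal.inertiaDeg_pos w.1.asIdeal (𝓞 K)) _ hq hα']
    refine Finset.prod_congr rfl fun w _ => ?_
    rw [Polynomial.map_sub, Polynomial.map_pow, map_X, map_C, hz1,
      residueCard_eq_residueCard_pow_inertiaDeg (F := K) (w := w.1)
        (by rw [← HeightOneSpectrum.under_asIdeal, (hmemS w.1).mp w.2]), Nat.cast_pow]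
  · -- modulo `𝔐`: `z_w ≡ s_w = ε_w` and `∏_w (X^{f_w} - s_w) = T` in `ℤ[X]`
    set Pℤ : ℤ[X] := ∏ w ∈ S.attach, (X ^ w.1.asIdeal.inertiaDeg (𝓞 K) - C (sgn w.1)) with hPℤ
    have hPT : Pℤ = T := by
      apply Polynomial.map_injective (Int.castRingHom ℂ) (RingHom.injective_int _)
      rw [← hT, hPℤ, Polynomial.map_prod, ← prod_attach S (fun w => X ^ w.asIdeal.inertiaDeg (𝓞 K) - C (ε w))]
      refine Finset.prod_congr rfl fun w _ => ?_
      rw [Polynomial.map_sub, Polynomial.map_pow, map_X, map_C, eq_intCast, hsgn]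
    rw [← hPT, hPℤ, Polynomial.map_prod, Polynomial.map_prod]
    refine Finset.prod_congr rfl fun w _ => ?_
    rw [Polynomial.map_sub, Polynomial.map_pow, map_X, map_C, hz2, Polynomial.map_sub, Polynomial.map_pow, map_X,
      map_C, eq_intCast, map_intCast]

end Hecke

/-! ### The decl -/

/-- **`ResidualAutomorphyEven`, granted non-normal cubic automorphic induction with archimedean components**
(`automorphicInduction_unitaryCharacter_cubic_archimedean`, JPSS 1981): the route decl verbatim, with
`P = AI_{E/K}(ε ψ χ₀)` and a maximal ideal `𝔐 ∋ 3` of `ℤ̄`. -/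
theorem residualAutomorphyEven_of_cubicAI_archimedean (hAI : automorphicInduction_unitaryCharacter_cubic_archimedean) :
    Summit.Langlands.Langlands.Theses.PicardMuOrdinary.ResidualAutomorphyEven := by
  intro f hcpt hdeg hsep hgal hreal
  set h : IsSepQuartic f := isSepQuartic_of_hyp hdeg hsep with hh
  have h12 : 12 ∣ Nat.card (G f) := twelve_dvd_card_G_of_hyp hdeg hsep hgal hreal
  have hlc : f.leadingCoeff ≠ 0 := leadingCoeff_ne_zero_of_hyp hdeg
  obtain ⟨𝔐, h𝔐, h3⟩ := IrregularClassicality.Negative.exists_isMaximal_three_mem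
  haveI := h𝔐
  -- the character `θ` and its induction
  obtain ⟨θ, p, q, hθu, hθinf, hinj, hcong, hdatum⟩ := exists_theta hdeg hsep hgal hreal 𝔐 h3
  obtain ⟨π, hSat, hArch⟩ := hAI K (E h) (finrank_E h h12) θ hθu hcpt hdatum
  refine ⟨π, 𝔐, ?_, h𝔐, h3, ?_⟩
  · -- regular algebraic: the archimedean parameter of `π_θ` and the fact's archimedean clause
    set hE := isCompact_glFiniteIntegralLevel_holds 1 (E h)
    obtain ⟨τ, hW, hW'⟩ := exists_automorphicRepData_detTwist_glOne hE θ
    obtain ⟨𝔫, h𝔫, hθ𝔫⟩ := HeckeCharacter.exists_level_glOne θ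
    have hτSat : ∀ᶠ w : HeightOneSpectrum (𝓞 (E h)) in cofinite, τ.HasSatakeParamAt w {θ.valueAtUniformizer w} := by
      filter_upwards [(Ideal.finite_factors h𝔫).compl_mem_cofinite] with w hw
      exact AutomorphicRepData.hasSatakeParamAt_detTwist_glOne hE hW hW' h𝔫 hθ𝔫 w hw (HeckeCharacter.valued_uniformizer w)
    have hχ : ∀ (g : (AdelicGroupData.gl 1 (E h)).Adelic), ∀ φ ∈ τ.W,
        rightTranslation (AdelicGroupData.gl 1 (E h)) g φ - ((θ (Matrix.GeneralLinearGroup.det g) : ℂˣ) : ℂ) • φ ∈ τ.W' := by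
      intro g φ hφ
      rw [hW] at hφ
      obtain ⟨c, rfl⟩ := Submodule.mem_span_singleton.mp hφ
      rw [hW', Submodule.mem_bot, map_smul, rightTranslation_detTwist_glOne, ← detTwist_apply, smul_comm, sub_self]
    have hτArch := AutomorphicRepData.hasArchParameter_of_hasInfinityType_heckeCharacter_glOne τ hχ hθinf
    have hπArch := hArch hE τ hτSat _ hτArch
    exact isRegularAlgebraic_of_archParameter (finrank_E h h12) π.1 p q hinj hπArch
  · -- the Hecke polynomials modulo `𝔐`
    have hmile := (eventually_finprod_eq_table f hdeg hsep hgal hreal).2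
    have hcong' := eventually_forall_under_eq (F := K) hcong
    filter_upwards [hSat, hcong', hmile] with v hv hcv hmv
    obtain ⟨α, hα, hpoly⟩ := hv
    have hsgnε : ∀ w : HeightOneSpectrum (𝓞 (E h)),
        (((if (eps h h12 hlc).valueAtUniformizer w = 1 then 1 else -1 : ℤ)) : ℂ) = (eps h h12 hlc).valueAtUniformizer w := by
      intro w
      rcases valueAtUniformizer_eps_eq_one_or h h12 hlc w with h1 | h1
      · rw [if_pos h1, h1]; norm_num
      · have hne : (eps h h12 hlc).valueAtUniformizer w ≠ 1 := by rw [h1]; norm_num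
        rw [if_neg hne, h1]; norm_num
    have hsgnZ : ∀ w : HeightOneSpectrum (𝓞 (E h)), Ideal.Quotient.mk 𝔐 (zlift ((eps h h12 hlc).valueAtUniformizer w)) =
        Ideal.Quotient.mk 𝔐 ((if (eps h h12 hlc).valueAtUniformizer w = 1 then 1 else -1 : ℤ) : integralClosure ℤ ℂ) := by
      intro w
      rcases valueAtUniformizer_eps_eq_one_or h h12 hlc w with h1 | h1
      · rw [if_pos h1, h1, zlift_one]; norm_num
      · have hne : (eps h h12 hlc).valueAtUniformizer w ≠ 1 := by rw [h1]; norm_num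
        rw [if_neg hne, h1, zlift_neg_one]; norm_num
    have hz : ∀ w : HeightOneSpectrum (𝓞 (E h)), w.under (𝓞 K) = v → ∃ z : integralClosure ℤ ℂ,
        algebraMap (integralClosure ℤ ℂ) ℂ z = (w.residueCard : ℂ) * θ.valueAtUniformizer w ∧
          Ideal.Quotient.mk 𝔐 z = Ideal.Quotient.mk 𝔐
            ((if (eps h h12 hlc).valueAtUniformizer w = 1 then 1 else -1 : ℤ) : integralClosure ℤ ℂ) := fun w hw => by
      obtain ⟨-, z, hz1, hz2⟩ := hcv w (by rw [← HeightOneSpectrum.under_asIdeal, hw])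
      exact ⟨z, hz1, hz2.trans (hsgnZ w)⟩
    obtain ⟨Q, hQ1, hQ2⟩ := exists_Q (L := E h) v θ 𝔐 _ (fun w => (eps h h12 hlc).valueAtUniformizer w)
      (fun w => if (eps h h12 hlc).valueAtUniformizer w = 1 then 1 else -1) hsgnε hpoly hz hmv
    exact ⟨α, Q, hα, hQ1, hQ2⟩

end ResidualAutomorphyEven

end Summit.Langlands.Langlands.Theorems
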